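import Mathlib
import HarnessLib
import HarnessLib.Audit
import Summits.Langlands.Statement

/-!
Route: TorsionKudlaMillson

CLOSED (retired) 2026-08-15T13:48:46Z by operator:999:1257524 — reason: not-a-thesis: assembly does not conclude the sub-problem Statement — note: D-0027 §2.1 audit (human 2026-08-15: routes that do not decide the summit are removed): the assembly concludes `GaloisRepWindowB`, not the sub-problem statement; a NEW conforming route may be opened from the same idea (generated `closes : … → _root_.Langlands`).. The file is kept as the record of this route; refuted decls are indexed as negative knowledge (`ledger negatives`).

Route TorsionKudlaMillson (realises idea card Langlands/Langlands/torsion-kudla-millson, with the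
host CORRECTED from the split orthogonal group to its quaternionic inner form; planner
planner-plancard-Langlands-Langlands-torsion--be042e3d-0, 2026-08-15).

THESIS X (it suffices to show) = `ConjAWindowH1`: Calegari–Geraghty's Conjecture A at Satake level,
in the bottom cuspidal degree q0 = 1, for the unit groups Γ = O^× of the quaternion orders O =
O_K<1,i,j,k> ⊂ (a,b)_K, where K is a number field with EXACTLY ONE complex place carrying an
involution σ whose fixed field F = K^σ is totally real ("the quadratic window"), a, b ∈ O_F \ 0, and
(a,b)_F is ramified at every real place of F that splits in K — so that Γ is an arithmetic Kleinian
group (cocompact as soon as [F:Q] ≥ 2). In words: for every finite commutative ring A and every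
additive character c : Γ → A that is an eigenvector of the Hecke operators T_v = [Γ g Γ] (nrd g = ϖ,
v = (ϖ) a principal prime of K with v ∤ 2ab·|A|; H^1-action through double-coset representatives,
Shimura 1971 §8.3), there is a locally constant 2-dimensional pseudo-representation (t, d) of
Gal(K̄/K) (t(1) = 2, d multiplicative, t central, t(x)t(y) = t(xy) + d(y)t(xy⁻¹)), unramified at
these v, with T_v c = t(Frob_v)·c and d(Frob_v) = q_v (arithmetic Frobenius). One-line Lean Prop:
the decl `ConjAWindowH1` of this file (QuaternionAlgebra K a 0 b,
NumberField.InfinitePlace.nrComplexPlaces, IsDedekindDomain.HeightOneSpectrum.primesAbove,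
Ideal.inertia, IsArithFrobAt, IsLocallyConstant — Mathlib +
Literature.NumberTheory.GaloisRepresentations.IntegralGaloisAction; lean check rc 0 in the planner's
Sketch.lean).

MECHANISM (the card's, transplanted to the quaternionic host): the genus-2 Kudla–Millson special
cycles of X = Γ\H^3 are the closed geodesics that are axes of norm-one elements γ ∈ Γ of infinite
order with reduced trace in F ("F-trace loxodromics": exactly the elements fixing pointwise a
totally positive F-rational 2-plane of the 4-dimensional quadratic F-space V with GSpin(V) = {x ∈
(a,b)_K^× : nrd x ∈ F^×}, of signature (4,0) at split and (3,1) at non-split real places of F).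
TORSION KUDLA–MILLSON (TKM): the c-twisted class-number series Θ(c) = Σ_T (Σ_{[γ] : Gram(γ) = T}
c(γ)) q^T should be the q-expansion of a mod-|A| Hilbert–Siegel modular form of genus 2 and parallel
weight 2 over F, Hecke-equivariantly (char 0: KudlaMillson1990 + HarrisSoudryTaylor1993); mod-p^m
Hilbert–Siegel eigensystems carry Galois pseudo-representations over F (GoldringKoskivirta2019-type,
Hodge type via G* = {ν ∈ Q^×}), whose restriction to K splits off (t, d). This is packaged as the
rank-2 crux `ThetaVisibleConjA` (= X for theta-visible c) and completed by the non-degeneracy crux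
`FTraceCongruenceGeneration` (F-trace loxodromics and commutators generate a congruence norm-one
subgroup) and the Eisenstein complement `EisensteinConjA`.

X → Statement: `Assembly : ThetaVisibleConjA → FTraceCongruenceGeneration → EisensteinConjA →
LimitBridge → GaloisRepWindowB`, where `GaloisRepWindowB` is the characteristic-0 shadow written in
the Statement's own vocabulary — the named fact lang.S27
`Literature.NumberTheory.Automorphic.exists_galoisRep_of_regularAlgebraic` with its hypothesis
`IsTotallyReal K ∨ IsCMField K` replaced by the window condition, for n = 2 and trivial central
character: a slice of the conjunct `Summit.Langlands.AutomorphicToGalois 2` (Satake–Frobenius clause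
`SatakeFrobCompatibleAt`-shape at unramified v ∤ ℓ; local–global compatibility and geometricity NOT
claimed). X is also the torsion input that Calegari–Geraghty patching (defect l0 = 1; Conjecture B
is automatic for compact 3-manifolds) consumes for direction (B) over the window — deliberately not
decomposed here.

Rationale: WHY THIS LINE. The card's split host O(V), V = 4-dim of discriminant K, cannot work for mixed
signature: genus-2 Kudla–Millson classes for signature (2,2)^a(3,1)^b live in H^b_c(X), dim X =
4a+3b, below the cuspidal range [2a+b, 2a+2b] unless a = 0 (K CM, where the output is Scholze2015);
for b = 1 the degree-1 classes are even congruence by CSP (SerreSL2Congruence1970). Passing to the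
inner form GSpin(V_B), B = (a,b)_F ramified at the a split real places, kills those factors: X_B =
Γ\(H^3)^b has cuspidal range [b, 2b] and the genus-2 cycles (dimension b) sit in the bottom degree
q0 = b. For b = 1 this is an arithmetic Kleinian group whose H_1 carries the exponential torsion of
the l0 = 1 regime (BergeronVenkatesh2012, MarshallMuller2013) and whose torsion eigensystems have NO
known Galois representations: not for [F:Q] ≥ 2 (Calegari2023 §10), and not even for [F:Q] = 1 when
(a,b)_K is a division algebra (compact 3-manifolds over imaginary quadratic K: no torsion
Jacquet–Langlands, CalegariVenkatesh2019). The card's concrete formulation — twisted class-number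
series of real-trace loxodromics of a Kleinian group are mod-N Siegel(-Hilbert) forms — survives
verbatim. Imported areas: theta correspondence / special cycles (KudlaMillson1990, Roberts2001),
pseudo-representations (Taylor1991), arithmetic Kleinian groups (VignerasLNM800).
RANKED CRUXES. #2 ThetaVisibleConjA — the engine's output (X for characters that see a special
geodesic); to be SPLIT in tenure into TKM modularity / integral Hecke-equivariance / mod-p^m
Hilbert–Siegel pseudo-reps once the requested definitions land. #3 FTraceCongruenceGeneration —
non-degeneracy: characters of Γ killing all F-trace loxodromics are congruence (repaired from the
naive 'generate Γ^ab', which is false: a prime of K inert over F dividing a gives an index-2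
residual torus obstruction). #4 FTraceGenerationBianchi — the same for SL_2(O_K), K imaginary
quadratic: cheapest machine test (presentations + Sengun2014Bianchi torsion tables). #5
EisensteinConjA — congruence eigen-characters are Galois-Eisenstein (CFT-level glue, filed as crux
because non-abelian congruence quotients at 2ab and the absence of global CFT in the tree make it
non-routine).
TARGET/SUPPORT. ConjAWindowH1 (rank 0) = X; GaloisRepWindowB (support) = char-0 (A)-slice in
Statement vocabulary, plausibly derivable already from ArthurClozel1989 + GeeTaibi2019 +
GoldringKoskivirta2019 + HarrisSoudryTaylor1993/BergerHarcos2007 (not found in print for mixed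
signature; Mok2014 is CM) — if so it becomes a named fact and the route's value is entirely in the
torsion cruxes; LimitBridge (support) = X → char 0 (Matsushima–Harder, jacquetLanglands_global,
Taylor1991 gluing; for nrRealPlaces K ≡ 2 mod 4 it needs mod-ℓ^m level raising in H^1 of Kleinian
groups).
KILL CRITERIA. (i) One p-torsion character of a Bianchi group SL_2(O_K) or of some Γ = O^× that
vanishes on all F-trace loxodromics (up to any congruence level) and is a cuspidal Hecke
eigen-character refutes #3/#4 and closes the route as a torsion engine (theta-blind torsion). (ii)
For a fixed (K, a, b, N), one violated linear relation among mod-N genus-2 q-expansions for Θ(c)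
(card's numerical protocol, run on cocompact Γ via SnapPy/Magma length-holonomy data) kills TKM and
hence the planned split of #2. (iii) A proof that GaloisRepWindowB follows from named facts does NOT
kill the route (it removes the char-0 anchor only).
CALIBRATION. [F:Q] = 1 with (a,b)_K ≅ M_2(K): Γ is a congruence subgroup commensurable with
GL_2(O_K) and X is Scholze2015 Thm 1.0.3 (up to the nilpotent ideal) — provers may discharge this
slice from a named fact once Scholze's theorem is vendored; it validates the typed normalisations
(T_v via [ΓgΓ], arithmetic Frobenius, d = q_v).
NOT DECOMPOSED YET (D-0019). The three TKM children of #2; the extraction of (t,d) over K from the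
4-dimensional pseudo-representation over F (HST §3 twisting); CG patching towards (B); local–global
compatibility at p (needed by CG, out of reach of theta); general central characters (HST's
restriction ω = χ∘N is intrinsic to the host); n ≥ 3.
DEFINITIONS REQUESTED. mod-N Hilbert–Siegel modular forms of genus 2 via q-expansions; Hecke
operators on Hom(Γ, A) by double cosets (Shimura §8.3 / Mathlib MonoidHom.transfer); the order
O_K<1,i,j,k>, its unit and congruence subgroups and the Kudla–Millson Gram datum of an F-trace
loxodromic (posited objects, Summits/Langlands/Langlands/Theorems).

Novelty: NEAREST PRIOR ART: HarrisSoudryTaylor1993 (doi:10.1007/bf01232440; with Taylor1994, BergerHarcos2007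
doi:10.1093/imrn/rnm113, Mok2014 for CM): the characteristic-0 theta transfer GO(3,1) → GSp_4
attaching Galois representations to Bianchi forms with central character from Q; KudlaMillson1990
(doi:10.1007/bf02699880): modularity of special-cycle generating series with COMPLEX coefficients;
CalegariVenkatesh2019 (doi:10.24033/ast.1075): torsion on quaternionic 3-manifolds over fields with
one complex place, numerically, without eigensystem transfer; Scholze2015: torsion Galois
representations for CONGRUENCE GL_n over CM/TR only; BoxerEtAl2021 (doi:10.1007/s10240-021-00128-2):
the (B)-side, char-0/coherent use of GSp_4 over F for elliptic curves over quadratic extensions of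
totally real fields. DELTA: (1) the conjecture that the cycle-level Kudla–Millson correspondence is
modular with Z/N coefficients for non-congruence characters of arithmetic Kleinian groups, used as a
torsion functoriality engine; (2) the corrected host — the quaternionic inner form ramified at the
split real places — which alone puts genus-2 cycles in the bottom cuspidal degree for K with one
complex place (the card's split host fails by a degree count); (3) a typed Satake-level Conjecture A
for unit groups of quaternion orders over the window (open even for compact 3-manifolds over
imaginary quadratic K), a typed non-degeneracy statement repaired against a residual-torus
obstruction, and a Bianchi calibrati  [refs: 10.1007/bf01232440, 10.1093/imrn/rnm113, 10.1007/bf02699880, 10.24033/ast.1075, 10.1007/s10240-021-00128-2, 10.21248/gups.90158, 10.1007/s00209-025-03683-0, 10.1017/s0010437x2610308x, 10.1007/bf01457221, 10.1215/00127094-2080850, 10.1007/s00209-020-02587-5, 10.1006/jnth.1998.2228, 10.4171/dm/104, 10.5802/jep.99, 10.1007/s00222-019-00882-5, doi:10.1007/bf01232440, doi:10.1093/imrn/rnm113, doi:10.10]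

Barriers (technique_class: torsion-theta kudla-millson special-cycles kleinian): technique_class: torsion-theta kudla-millson special-cycles kleinian
- Literature.Barriers.Langlands.ShimuraVarietyRealizationBarrier: APPLIES to the window
(Res_{K/Q}GL_2, K with a real and a complex place, has l0 = 1 > 0: no Shimura variety, and
U_{K/F}(2,2) is GL_4(R) at the split place so Scholze's boundary trick is unavailable). EVADED in
the only way the barrier allows: nothing is realised over K; topological classes (characters of the
Kleinian group Γ) are pushed by an integral theta kernel to q-expansions over the totally real F,
where Hilbert–Siegel varieties (Hodge type via G*) exist. The barrier's own invariant decides the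
host: the split orthogonal host keeps an equal-rank-defect factor at split real places (genus-2
classes land in H^b, outside [2a+b, 2a+2b]); the quaternionic host compactifies them away (this
file's correction).
- Literature.Barriers.Langlands.NonRegularWeightBarrier: EVADED/NOT ENGAGED: torsion characters
carry no archimedean weight; the target weight on GSp_4/F is the parallel-weight-2 holomorphic limit
of discrete series, handled mod p by (strata) Hasse invariants in coherent cohomology
(GoldringKoskivirta2019), not by Betti/p-adic interpolation of regular weights.
- Literature.Barriers.Langlands.TwistedEndoscopySelfDual: NOT MET: the transfer GO(V_B) → GSp_4 is a
theta correspondence realised by cycles, not a twisted trace-formula comparison; for n = 2 the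
symplectic self-duality of Ind_K^F ρ (multiplier from F) is automatic. Honest limit: th

History (route lifecycle, newest last):
- 2026-08-15T13:48:46Z · CLOSED retired — not-a-thesis: assembly does not conclude the sub-problem Statement (operator:999:1257524)

sub-problem: Langlands · status: closed(retired) · opened planner-plancard-Langlands-Langlands-torsion--be042e3d-0 2026-08-15T11:11:43Z · rev 1 · ledger route-Langlands-TorsionKudlaMillson
GENERATED by the gate from the ledger (D-0016/17). Provers cite these decls: `theorem foo : Summit.Langlands.Langlands.Theses.TorsionKudlaMillson.<Decl> := …` in Summits/Langlands/Langlands/Theorems/<Name>.lean.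
-/

namespace Summit.Langlands.Langlands.Theses.TorsionKudlaMillson

open scoped BigOperators Topology Manifold Classical MeasureTheory ProbabilityTheory Matrix InnerProductSpace ComplexConjugate ContinuousMap
open Filter Set Function TopologicalSpace MeasureTheory

attribute [summit_statement] _root_.Langlands

/-- item stmt-Langlands-3118 · target · rank 0 · closed · moot by None · by planner
why it might fail: Only if mod-p^m reciprocity (CG Conj. A) fails for unit groups of quaternion orders — open even for compact quotients over imaginary quadratic K (no Hecke-equivariant torsion JL). Typed risks re-checked benign (one double coset per tested v; S_v = 1 so d = χ_cyc); char-2 pseudo-reps only weaken X.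
sources: CalegariGeraghty2017, Scholze2015, CalegariVenkatesh2019, Calegari2023, Shimura1971
[target] X = Calegari–Geraghty Conjecture A at Satake level in degree q0 = 1 for the unit groups Γ =
O^× of the quaternion orders O = O_K<1,i,j,k> ⊂ (a,b)_K over the quadratic window (K with exactly
one complex place, involution σ with totally real fixed field F, a,b ∈ O_F nonzero, (a,b)_F ramified
at the real places of F split in K, so Γ is an arithmetic Kleinian group, cocompact for [F:Q] ≥ 2):
every additive Hecke eigen-character c : Γ → A (A any finite commutative ring; T_v = [Γ g Γ], nrd g
= ϖ, v = (ϖ) principal with v ∤ 2ab|A|; H^1-action via double-coset representatives, Shimura 1971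
§8.3) has a locally constant 2-dimensional pseudo-representation (t,d) of Gal(K̄/K), unramified at
such v, with T_v c = t(Frob_v)·c and d(Frob_v) = q_v (arithmetic Frobenius). Regimes: [F:Q] = 1 and
(a,b)_K ≅ M_2(K): Bianchi congruence level — KNOWN (Scholze2015 Thm 1.0.3, up to the nilpotent
ideal): calibration of the typed normalisations; [F:Q] = 1 and (a,b)_K division: compact arithmetic
3-manifolds over imaginary quadratic K — OPEN (no torsion Jacquet–Langlands, CalegariVenkatesh2019);
[F:Q] ≥ 2: the window proper — OPEN (Calegari2023 §10). Follows by pure logic from ThetaVisibleConjA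
+ FTra -/
@[route_item "route-Langlands-TorsionKudlaMillson"]
def ConjAWindowH1 : Prop :=
  ∀ (K : Type) [Field K] [NumberField K] (σ : K ≃+* K) (a b : NumberField.RingOfIntegers K), NumberField.InfinitePlace.nrComplexPlaces K = 1 → σ ≠ RingEquiv.refl K → σ.trans σ = RingEquiv.refl K → (∀ φ : K →+* ℂ, (starRingEnd ℂ).comp φ = φ ∨ (starRingEnd ℂ).comp φ = φ.comp σ.toRingHom) → σ a = a → σ b = b → a ≠ 0 → b ≠ 0 → (∀ φ : K →+* ℂ, (starRingEnd ℂ).comp φ = φ → (φ a).re < 0 ∧ (φ b).re < 0) → let IsInt : QuaternionAlgebra K (a : K) 0 (b : K) → Prop := fun x => ∀ i : Fin 4, QuaternionAlgebra.equivTuple (a : K) 0 (b : K) x i ∈ Set.range (algebraMap (NumberField.RingOfIntegers K) K); let IsG : (QuaternionAlgebra K (a : K) 0 (b : K))ˣ → Prop := fun u => IsInt (u : QuaternionAlgebra K (a : K) 0 (b : K)) ∧ IsInt ((u⁻¹ : (QuaternionAlgebra K (a : K) 0 (b : K))ˣ) : QuaternionAlgebra K (a : K) 0 (b : K)); ∀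 (A : Type) [CommRing A] [Finite A], let HR : ((QuaternionAlgebra K (a : K) 0 (b : K))ˣ → A) → (QuaternionAlgebra K (a : K) 0 (b : K))ˣ → A → Prop := fun c g l => ∃ (k : ℕ) (r : Fin k → (QuaternionAlgebra K (a : K) 0 (b : K))ˣ), (∀ i, ∃ γ₁ γ₂, IsG γ₁ ∧ IsG γ₂ ∧ r i = γ₁ * g * γ₂) ∧ (∀ γ₁ γ₂, IsG γ₁ → IsG γ₂ → ∃! i, ∃ γ, IsG γ ∧ γ₁ * g * γ₂ = γ * r i) ∧ (∀ γ, IsG γ → ∀ (s : Fin k → Fin k) (e : Fin k → (QuaternionAlgebra K (a : K) 0 (b : K))ˣ), (∀ i, IsG (e i) ∧ r i * γ = e i * r (s i)) → ∑ i, c (e i) = l * c γ); let PR : (Field.absoluteGaloisGroup K → A) → (Field.absoluteGaloisGroup K → A) → Prop := fun t d => t 1 = 2 ∧ d 1 = 1 ∧ (∀ x y, d (x * y) = d x * d y) ∧ (∀ x y, t (x * y) = t (y * x)) ∧ (∀ x y, t x * t y = t (x * y) + d y * t (x * y⁻¹)) ∧ IsLocallyConstant t ∧ IsLocallyConstant d;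 ∀ (c : (QuaternionAlgebra K (a : K) 0 (b : K))ˣ → A), (∀ x y, IsG x → IsG y → c (x * y) = c x + c y) → (∀ (ϖ : NumberField.RingOfIntegers K) (g : (QuaternionAlgebra K (a : K) 0 (b : K))ˣ) (v : IsDedekindDomain.HeightOneSpectrum (NumberField.RingOfIntegers K)), Prime ϖ → v.asIdeal = Ideal.span {ϖ} → IsInt (g : QuaternionAlgebra K (a : K) 0 (b : K)) → (g : QuaternionAlgebra K (a : K) 0 (b : K)) * star (g : QuaternionAlgebra K (a : K) 0 (b : K)) = algebraMap K (QuaternionAlgebra K (a : K) 0 (b : K)) (ϖ : K) → (2 * a * b * (Nat.card A : NumberField.RingOfIntegers K) : NumberField.RingOfIntegers K) ∉ v.asIdeal → ∃ l : A, HR c g l) → ∃ t d : Field.absoluteGaloisGroup K → A, PR t d ∧ ∀ (ϖ : NumberField.RingOfIntegers K) (g : (QuaternionAlgebra K (a : K) 0 (b : K))ˣ) (v : IsDedekindDomain.HeightOneSpectrum (NumberField.RingOfIntegers K)), Prime ϖ → v.asIdeal = Ideal.span {ϖ} → IsInt (g : QuaternionAlgebra K (a : K) 0 (b : K)) → (g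 : QuaternionAlgebra K (a : K) 0 (b : K)) * star (g : QuaternionAlgebra K (a : K) 0 (b : K)) = algebraMap K (QuaternionAlgebra K (a : K) 0 (b : K)) (ϖ : K) → (2 * a * b * (Nat.card A : NumberField.RingOfIntegers K) : NumberField.RingOfIntegers K) ∉ v.asIdeal → ∀ 𝔓 ∈ v.primesAbove, (∀ τ ∈ 𝔓.inertia (Field.absoluteGaloisGroup K), ∀ s, t (s * τ) = t s ∧ d (s * τ) = d s) ∧ ∀ s, IsArithFrobAt (NumberField.RingOfIntegers K) s 𝔓 → HR c g (t s) ∧ d s = (v.residueCard : A)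

/-- item stmt-Langlands-3119 · crux · rank 2 · closed · moot by None · by planner
why it might fail: Θ(c) with Z/|A| coefficients may not be a mod-|A| Hilbert–Siegel form (no integral KM theory for torsion classes); theta dichotomy for (O(V),Sp_4), dim V=4, can put first occurrence at genus 3, killing the genus-2 lift of cuspidal c; torsion pseudo-reps of wt-2 Hilbert–Siegel classes (F≠Q) unproved.
sources: KudlaMillson1990, HarrisSoudryTaylor1993, Roberts2001, Taylor1991, Taylor1994, GoldringKoskivirta2019
[crux] THE TORSION KUDLA–MILLSON ENGINE (card torsion-kudla-millson on the quaternionic host): the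
conclusion of X for eigen-characters c that are THETA-VISIBLE, i.e. c(γ) ≠ 0 for some norm-one γ ∈ Γ
of infinite order with reduced trace in F = K^σ. These γ are exactly the elements fixing pointwise a
totally positive F-rational 2-plane of the 4-dimensional quadratic F-space V with GSpin(V) = {x ∈
(a,b)_K^× : nrd x ∈ F^×} (signature (4,0) at split, (3,1) at non-split real places of F); their axes
are the genus-2 Kudla–Millson special cycles = closed geodesics of X = Γ\H^3 (for (a,b)_K ≅ M_2(C)
at the complex place: γ = diag(λ,λ⁻¹) fixes {[[0,z],[z̄,0]]}, positive for -det, iff λ is real).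
INTENDED PROOF = the planned tenure split once the requested definitions land: (i) TKM MODULARITY —
the c-twisted class-number series Θ(c) = Σ_T (Σ_{[γ] : Gram(γ) = T} c(γ)) q^T (T ∈ Sym_2(O_F)
totally positive) is the q-expansion of a mod-|A| Hilbert–Siegel modular form of genus 2 and
parallel weight 2 over F, level from (a,b,N) (char 0 = KudlaMillson1990 Thm +
HarrisSoudryTaylor1993; candidate mechanisms: a lattice in the Weil representation of Sp_4 × O(V)
over Z[1/2abN] making the KM class integr -/
@[route_item "route-Langlands-TorsionKudlaMillson"]
def ThetaVisibleConjA : Prop :=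
  ∀ (K : Type) [Field K] [NumberField K] (σ : K ≃+* K) (a b : NumberField.RingOfIntegers K), NumberField.InfinitePlace.nrComplexPlaces K = 1 → σ ≠ RingEquiv.refl K → σ.trans σ = RingEquiv.refl K → (∀ φ : K →+* ℂ, (starRingEnd ℂ).comp φ = φ ∨ (starRingEnd ℂ).comp φ = φ.comp σ.toRingHom) → σ a = a → σ b = b → a ≠ 0 → b ≠ 0 → (∀ φ : K →+* ℂ, (starRingEnd ℂ).comp φ = φ → (φ a).re < 0 ∧ (φ b).re < 0) → let IsInt : QuaternionAlgebra K (a : K) 0 (b : K) → Prop := fun x => ∀ i : Fin 4, QuaternionAlgebra.equivTuple (a : K) 0 (b : K) x i ∈ Set.range (algebraMap (NumberField.RingOfIntegers K) K); let IsG : (QuaternionAlgebra K (a : K) 0 (b : K))ˣ → Prop := fun u => IsInt (u : QuaternionAlgebra K (a : K) 0 (b : K)) ∧ IsInt ((u⁻¹ : (QuaternionAlgebra K (a : K) 0 (b : K))ˣ) : QuaternionAlgebra K (a : K) 0 (b : K)); let FTr : (QuaternionAlgebra K (a : K) 0 (b : K))ˣ → Prop := fun u => IsG u ∧ (u : QuaternionAlgebra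 K (a : K) 0 (b : K)) * star (u : QuaternionAlgebra K (a : K) 0 (b : K)) = 1 ∧ σ (u : QuaternionAlgebra K (a : K) 0 (b : K)).re = (u : QuaternionAlgebra K (a : K) 0 (b : K)).re ∧ ¬ IsOfFinOrder u; ∀ (A : Type) [CommRing A] [Finite A], let HR : ((QuaternionAlgebra K (a : K) 0 (b : K))ˣ → A) → (QuaternionAlgebra K (a : K) 0 (b : K))ˣ → A → Prop := fun c g l => ∃ (k : ℕ) (r : Fin k → (QuaternionAlgebra K (a : K) 0 (b : K))ˣ), (∀ i, ∃ γ₁ γ₂, IsG γ₁ ∧ IsG γ₂ ∧ r i = γ₁ * g * γ₂) ∧ (∀ γ₁ γ₂, IsG γ₁ → IsG γ₂ → ∃! i, ∃ γ, IsG γ ∧ γ₁ * g * γ₂ = γ * r i) ∧ (∀ γ, IsG γ → ∀ (s : Fin k → Fin k) (e : Fin k → (QuaternionAlgebra K (a : K) 0 (b : K))ˣ), (∀ i, IsG (e i) ∧ r i * γ = e i * r (s i)) → ∑ i, c (e i) = l * c γ); let PR : (Field.absoluteGaloisGroup K → A) → (Field.absoluteGaloisGroup K → A) → Prop := fun t d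 => t 1 = 2 ∧ d 1 = 1 ∧ (∀ x y, d (x * y) = d x * d y) ∧ (∀ x y, t (x * y) = t (y * x)) ∧ (∀ x y, t x * t y = t (x * y) + d y * t (x * y⁻¹)) ∧ IsLocallyConstant t ∧ IsLocallyConstant d; ∀ (c : (QuaternionAlgebra K (a : K) 0 (b : K))ˣ → A), (∀ x y, IsG x → IsG y → c (x * y) = c x + c y) → (∃ γ, FTr γ ∧ c γ ≠ 0) → (∀ (ϖ : NumberField.RingOfIntegers K) (g : (QuaternionAlgebra K (a : K) 0 (b : K))ˣ) (v : IsDedekindDomain.HeightOneSpectrum (NumberField.RingOfIntegers K)), Prime ϖ → v.asIdeal = Ideal.span {ϖ} → IsInt (g : QuaternionAlgebra K (a : K) 0 (b : K)) → (g : QuaternionAlgebra K (a : K) 0 (b : K)) * star (g : QuaternionAlgebra K (a : K) 0 (b : K)) = algebraMap K (QuaternionAlgebra K (a : K) 0 (b : K)) (ϖ : K) → (2 * a * b * (Nat.card A : NumberField.RingOfIntegers K) : NumberField.RingOfIntegers K) ∉ v.asIdeal → ∃ l : A, HR c g l) → ∃ t d : Field.absoluteGaloisGroup K → A, PR t d ∧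 ∀ (ϖ : NumberField.RingOfIntegers K) (g : (QuaternionAlgebra K (a : K) 0 (b : K))ˣ) (v : IsDedekindDomain.HeightOneSpectrum (NumberField.RingOfIntegers K)), Prime ϖ → v.asIdeal = Ideal.span {ϖ} → IsInt (g : QuaternionAlgebra K (a : K) 0 (b : K)) → (g : QuaternionAlgebra K (a : K) 0 (b : K)) * star (g : QuaternionAlgebra K (a : K) 0 (b : K)) = algebraMap K (QuaternionAlgebra K (a : K) 0 (b : K)) (ϖ : K) → (2 * a * b * (Nat.card A : NumberField.RingOfIntegers K) : NumberField.RingOfIntegers K) ∉ v.asIdeal → ∀ 𝔓 ∈ v.primesAbove, (∀ τ ∈ 𝔓.inertia (Field.absoluteGaloisGroup K), ∀ s, t (s * τ) = t s ∧ d (s * τ) = d s) ∧ ∀ s, IsArithFrobAt (NumberField.RingOfIntegers K) s 𝔓 → HR c g (t s) ∧ d s = (v.residueCard : A)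

/-- item stmt-Langlands-3120 · crux · rank 3 · closed · moot by None · by planner
why it might fail: In the l0=1 regime H_1-torsion grows exponentially (BergeronVenkatesh2012); nothing forces a p-torsion character to see a special geodesic; even rationally, spanning H_1 mod congruence homology needs genus-2 theta non-vanishing for all cuspidal π, known only for tempered π up to twist (Roberts2001).
sources: BergeronVenkatesh2012, MarshallMuller2013, Roberts2001, HarrisSoudryTaylor1993, KudlaMillson1990, BergeronMillsonMoeglin2016
[crux] NON-DEGENERACY of the torsion theta kernel (card crux C3 made precise and REPAIRED): for some
N ≥ 1 every norm-one unit of O congruent to 1 mod N·O lies in the subgroup of (a,b)_K^× generated by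
the theta-visible elements (units of O of norm one, infinite order, reduced trace in F) and the
commutators of Γ = O^×; equivalently every character of Γ that kills all special-geodesic classes is
a congruence (Eisenstein) character. Char-0 content: Kudla–Millson classes span H_1(X_Γ, Q) modulo
congruence homology (KudlaMillson1990 + non-vanishing of Θ : GO(4) → GSp_4, HarrisSoudryTaylor1993 /
Roberts2001, + persistence for base-change classes; BergeronMillsonMoeglin2016 is the analogue in
higher rank); torsion content NEW. The naive form 'F-trace elements generate Γ^{ab}' is FALSE
(planner, 2026-08-15): at a prime 𝔭 | a of K inert over F, Γ ↠ (O/𝔭O)^× ↠ F_q^× with q = q_F^2 and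
the residues s of F-trace norm-one elements satisfy s + 1/s ∈ F_{q_F}, so they generate the index-2
subgroup generated by F_{q_F}^× and μ_{q_F+1}; hence the congruence slack N and the restriction to
norm one. Cheapest test: a presentation of Γ (Magma / SnapPy for arithmetic Kleinian groups; for
[F:Q] = 1 Page -/
@[route_item "route-Langlands-TorsionKudlaMillson"]
def FTraceCongruenceGeneration : Prop :=
  ∀ (K : Type) [Field K] [NumberField K] (σ : K ≃+* K) (a b : NumberField.RingOfIntegers K), NumberField.InfinitePlace.nrComplexPlaces K = 1 → σ ≠ RingEquiv.refl K → σ.trans σ = RingEquiv.refl K → (∀ φ : K →+* ℂ, (starRingEnd ℂ).comp φ = φ ∨ (starRingEnd ℂ).comp φ = φ.comp σ.toRingHom) → σ a = a → σ b = b → a ≠ 0 → b ≠ 0 → (∀ φ : K →+* ℂ, (starRingEnd ℂ).comp φ = φ → (φ a).re < 0 ∧ (φ b).re < 0) → let IsInt : QuaternionAlgebra K (a : K) 0 (b : K) → Prop := fun x => ∀ i : Fin 4, QuaternionAlgebra.equivTuple (a : K) 0 (b : K) x i ∈ Set.range (algebraMap (NumberField.RingOfIntegers K) K); let IsG : (QuaternionAlgebra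 K (a : K) 0 (b : K))ˣ → Prop := fun u => IsInt (u : QuaternionAlgebra K (a : K) 0 (b : K)) ∧ IsInt ((u⁻¹ : (QuaternionAlgebra K (a : K) 0 (b : K))ˣ) : QuaternionAlgebra K (a : K) 0 (b : K)); let Cong : ℕ → (QuaternionAlgebra K (a : K) 0 (b : K))ˣ → Prop := fun N u => IsG u ∧ ∀ i : Fin 4, QuaternionAlgebra.equivTuple (a : K) 0 (b : K) ((u : QuaternionAlgebra K (a : K) 0 (b : K)) - 1) i ∈ Set.range (fun y : NumberField.RingOfIntegers K => ((N : NumberField.RingOfIntegers K) * y : K)); let FTr : (QuaternionAlgebra K (a : K) 0 (b : K))ˣ → Prop := fun u => IsG u ∧ (u : QuaternionAlgebra K (a : K) 0 (b : K)) * star (u : QuaternionAlgebra K (a : K) 0 (b : K)) = 1 ∧ σ (u : QuaternionAlgebra K (a : K) 0 (b : K)).re = (u : QuaternionAlgebra K (a : K) 0 (b : K)).re ∧ ¬ IsOfFinOrder u; ∃ N : ℕ, 0 < N ∧ ∀ γ, Cong N γ → (γ : QuaternionAlgebra K (a : K) 0 (b : K)) * star (γ : QuaternionAlgebra K (a : K)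 0 (b : K)) = 1 → γ ∈ Subgroup.closure ({u | FTr u} ∪ {w | ∃ u v, IsG u ∧ IsG v ∧ w = u * v * u⁻¹ * v⁻¹})

/-- item stmt-Langlands-3121 · crux · rank 4 · closed · moot by None · by planner
why it might fail: Trivial for Euclidean d (SL_2(O_d)=E_2; Swan1971); for other d SL_2(O_d)/NE_2·[Γ,Γ] is large (Swan generators, Zimmert/Grunewald–Schwermer free quotients; CSP fails, Serre1970): one non-congruence or p-torsion character killing all integer-trace infinite-order elements refutes it; none computed yet.
sources: Swan1971, SerreSL2Congruence1970, Sengun2014Bianchi, Roberts2001, KudlaMillson1990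
[crux] CALIBRATION and cheapest falsifier, classical Bianchi form of the non-degeneracy: for K
imaginary quadratic and Γ = SL_2(O_K), some principal congruence subgroup Γ(N) is contained in
⟨integer-trace elements of infinite order⟩ · [Γ,Γ] — characters of a Bianchi group vanishing on all
integer-trace loxodromics and parabolics are congruence. Rational part: cuspidal H_1 is spanned by
real-trace closed geodesics (KudlaMillson1990 + HarrisSoudryTaylor1993 non-vanishing at level one,
trivial central character) and Eisenstein H_1 by parabolics (trace 2); the torsion part is open and
machine-testable today (Swan/Riley/Page presentations of SL_2(O_K) in GAP/Magma, abelianisation,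
enumeration of integer-trace elements by height; stress tests: fields with large non-congruence H_1
and p-torsion from Sengun2014Bianchi, Grunewald–Schwermer free quotients). A prover/refuter with kit
compute can settle many (K, p) instances either way. -/
@[route_item "route-Langlands-TorsionKudlaMillson"]
def FTraceGenerationBianchi : Prop :=
  ∀ (K : Type) [Field K] [NumberField K], Module.finrank ℚ K = 2 → NumberField.InfinitePlace.nrComplexPlaces K = 1 → ∃ N : ℕ, 0 < N ∧ (Matrix.SpecialLinearGroup.map (Ideal.Quotient.mk (Ideal.span {(N : NumberField.RingOfIntegers K)}))).ker ≤ Subgroup.closure {γ : Matrix.SpecialLinearGroup (Fin 2) (NumberField.RingOfIntegers K) | (∃ n : ℤ, Matrix.trace γ.1 = (n : NumberField.RingOfIntegers K)) ∧ ¬ IsOfFinOrder γ} ⊔ commutator (Matrix.SpecialLinearGroup (Fin 2) (NumberField.RingOfIntegers K))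

/-- item stmt-Langlands-3122 · support · rank 5 · closed · moot by None · by planner
why it might fail: Not expected to fail: the only live issue is proof weight in Lean (quadratic class field theory over K is not in the tree), not truth.
sources: CalegariVenkatesh2019, arXiv:1212.3847, Chevalley1951, Shimura1971
[crux] EISENSTEIN / CONGRUENCE complement: the conclusion of X for eigen-characters c of Γ = O^×
that vanish on a norm-one principal congruence subgroup Γ^1(N) = {u ∈ O^× : u ≡ 1 mod N·O, nrd u =
1}. Expected: such c factor through O^×/Γ^1(N), an extension of a finite congruence quotient by unit
norms, and are Galois-Eisenstein: e.g. c = ψ ∘ nrd has T_v-eigenvalue q_v + 1 at every good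
principal v (direct computation from the double-coset formula) and (t,d) = (1 + cyclotomic,
cyclotomic) mod |A| works; in general t = χ_1 + χ_2 from class field theory of K. It is the glue
that turns ThetaVisibleConjA + FTraceCongruenceGeneration into X. Filed as a (low-rank) crux rather
than support because the congruence quotients at primes dividing 2ab are non-abelian/solvable and
global CFT for K is absent from the tree. -/
@[route_item "route-Langlands-TorsionKudlaMillson"]
def EisensteinConjA : Prop :=
  ∀ (K : Type) [Field K] [NumberField K] (σ : K ≃+* K) (a b : NumberField.RingOfIntegers K), NumberField.InfinitePlace.nrComplexPlaces K = 1 → σ ≠ RingEquiv.refl K → σ.trans σ = RingEquiv.refl K → (∀ φ : K →+* ℂ, (starRingEnd ℂ).comp φ = φ ∨ (starRingEnd ℂ).comp φ = φ.comp σ.toRingHom) → σ a = a → σ b = b → a ≠ 0 → b ≠ 0 → (∀ φ : K →+* ℂ, (starRingEnd ℂ).comp φ = φ → (φ a).re < 0 ∧ (φ b).re < 0) → let IsInt : QuaternionAlgebra K (a : K) 0 (b : K) → Prop := fun x => ∀ i : Fin 4, QuaternionAlgebra.equivTuple (a : K) 0 (b : K) x i ∈ Set.range (algebraMap (NumberField.RingOfIntegers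 K) K); let IsG : (QuaternionAlgebra K (a : K) 0 (b : K))ˣ → Prop := fun u => IsInt (u : QuaternionAlgebra K (a : K) 0 (b : K)) ∧ IsInt ((u⁻¹ : (QuaternionAlgebra K (a : K) 0 (b : K))ˣ) : QuaternionAlgebra K (a : K) 0 (b : K)); let Cong : ℕ → (QuaternionAlgebra K (a : K) 0 (b : K))ˣ → Prop := fun N u => IsG u ∧ ∀ i : Fin 4, QuaternionAlgebra.equivTuple (a : K) 0 (b : K) ((u : QuaternionAlgebra K (a : K) 0 (b : K)) - 1) i ∈ Set.range (fun y : NumberField.RingOfIntegers K => ((N : NumberField.RingOfIntegers K) * y : K)); ∀ (A : Type) [CommRing A] [Finite A], let HR : ((QuaternionAlgebra K (a : K) 0 (b : K))ˣ → A) → (QuaternionAlgebra K (a : K) 0 (b : K))ˣ → A → Prop := fun c g l => ∃ (k : ℕ) (r : Fin k → (QuaternionAlgebra K (a : K) 0 (b : K))ˣ), (∀ i, ∃ γ₁ γ₂, IsG γ₁ ∧ IsG γ₂ ∧ r i = γ₁ * g * γ₂) ∧ (∀ γ₁ γ₂, IsG γ₁ → IsG γ₂ → ∃! i, ∃ γ,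 IsG γ ∧ γ₁ * g * γ₂ = γ * r i) ∧ (∀ γ, IsG γ → ∀ (s : Fin k → Fin k) (e : Fin k → (QuaternionAlgebra K (a : K) 0 (b : K))ˣ), (∀ i, IsG (e i) ∧ r i * γ = e i * r (s i)) → ∑ i, c (e i) = l * c γ); let PR : (Field.absoluteGaloisGroup K → A) → (Field.absoluteGaloisGroup K → A) → Prop := fun t d => t 1 = 2 ∧ d 1 = 1 ∧ (∀ x y, d (x * y) = d x * d y) ∧ (∀ x y, t (x * y) = t (y * x)) ∧ (∀ x y, t x * t y = t (x * y) + d y * t (x * y⁻¹)) ∧ IsLocallyConstant t ∧ IsLocallyConstant d; ∀ (c : (QuaternionAlgebra K (a : K) 0 (b : K))ˣ → A), (∀ x y, IsG x → IsG y → c (x * y) = c x + c y) → (∃ N : ℕ, 0 < N ∧ ∀ γ, Cong N γ → (γ : QuaternionAlgebra K (a : K) 0 (b : K)) * star (γ : QuaternionAlgebra K (a : K) 0 (b : K)) = 1 → c γ = 0) → (∀ (ϖ : NumberField.RingOfIntegers K) (g : (QuaternionAlgebra K (a : K) 0 (b : K))ˣ) (v : IsDedekindDomain.HeightOneSpectrum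 (NumberField.RingOfIntegers K)), Prime ϖ → v.asIdeal = Ideal.span {ϖ} → IsInt (g : QuaternionAlgebra K (a : K) 0 (b : K)) → (g : QuaternionAlgebra K (a : K) 0 (b : K)) * star (g : QuaternionAlgebra K (a : K) 0 (b : K)) = algebraMap K (QuaternionAlgebra K (a : K) 0 (b : K)) (ϖ : K) → (2 * a * b * (Nat.card A : NumberField.RingOfIntegers K) : NumberField.RingOfIntegers K) ∉ v.asIdeal → ∃ l : A, HR c g l) → ∃ t d : Field.absoluteGaloisGroup K → A, PR t d ∧ ∀ (ϖ : NumberField.RingOfIntegers K) (g : (QuaternionAlgebra K (a : K) 0 (b : K))ˣ) (v : IsDedekindDomain.HeightOneSpectrum (NumberField.RingOfIntegers K)), Prime ϖ → v.asIdeal = Ideal.span {ϖ} → IsInt (g : QuaternionAlgebra K (a : K) 0 (b : K)) → (g : QuaternionAlgebra K (a : K) 0 (b : K)) * star (g : QuaternionAlgebra K (a : K) 0 (b : K)) = algebraMap K (QuaternionAlgebra K (a : K) 0 (b : K)) (ϖ : K) → (2 * a * b * (Nat.card A : NumberField.RingOfIntegers K) : NumberField.RingOfIntegers K) ∉ v.asIdeal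 → ∀ 𝔓 ∈ v.primesAbove, (∀ τ ∈ 𝔓.inertia (Field.absoluteGaloisGroup K), ∀ s, t (s * τ) = t s ∧ d (s * τ) = d s) ∧ ∀ s, IsArithFrobAt (NumberField.RingOfIntegers K) s 𝔓 → HR c g (t s) ∧ d s = (v.residueCard : A)

/-- item stmt-Langlands-3123 · support · rank 8 · closed · moot by None · by planner
sources: HarrisSoudryTaylor1993, GeeTaibi2019, GoldringKoskivirta2019, ArthurClozel1989, Mok2014, BoxerEtAl2021
[support] CHARACTERISTIC-0 SHADOW in the Statement's vocabulary (the Assembly's consequent):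
lang.S27 `Literature.NumberTheory.Automorphic.exists_galoisRep_of_regularAlgebraic` with
`IsTotallyReal K ∨ IsCMField K` replaced by the window condition (nrComplexPlaces K = 1, involution
σ with totally real fixed field), for n = 2 and π of trivial central character (Satake α.prod = 1 at
every unramified v; Chebotarev makes ω_π = 1): a slice of `Summit.Langlands.AutomorphicToGalois 2`
(Satake–Frobenius clause only, unitary normalisation m = 2 as in lang.S27; LGC/geometricity not
claimed). PLAUSIBLY ALREADY A THEOREM modulo assembly: automorphic induction to GL_4/F
(ArthurClozel1989) + descent to GSp_4/F and Arthur's multiplicity formula (GeeTaibi2019: the stable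
packet of Ind_K^F ρ_π contains the member holomorphic of parallel weight 2 at every real place — the
Yoshida-type limit of discrete series, θ(1 of O(4)) at split places) + Galois pseudo-representations
for weight-2 Hilbert–Siegel eigenforms (Taylor1991 over Q; GoldringKoskivirta2019 over F, Hodge type
via G*) + extraction over K (HarrisSoudryTaylor1993 §3, BergerHarcos2007). NOT found stated in print
for mixed signature (Mok2014 is -/
@[route_item "route-Langlands-TorsionKudlaMillson"]
def GaloisRepWindowB : Prop :=
  ∀ (K : Type) [Field K] [NumberField K] (hcpt : Literature.NumberTheory.Automorphic.isCompact_glFiniteIntegralLevel 2 K) (σ : K ≃+* K), NumberField.InfinitePlace.nrComplexPlaces K = 1 → σ ≠ RingEquiv.refl K → σ.trans σ = RingEquiv.refl K → (∀ φ : K →+* ℂ, (starRingEnd ℂ).comp φ = φ ∨ (starRingEnd ℂ).comp φ = φ.comp σ.toRingHom) → ∀ (π : Literature.NumberTheory.Automorphic.CuspidalAutomorphicRepData 2 K hcpt), π.1.IsRegularAlgebraic → (∀ (v : IsDedekindDomain.HeightOneSpectrum (NumberField.RingOfIntegers K)) (α : Multiset ℂ), π.1.HasSatakeParamAt v α → α.prod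 = 1) → ∀ (ℓ : ℕ) [Fact ℓ.Prime] (ι : PadicAlgCl ℓ ≃+* ℂ), ∃ r : Literature.NumberTheory.GaloisRepresentations.FramedGaloisRep K (PadicAlgCl ℓ) 2, r.toGaloisRep.IsSemisimple ∧ ∀ (v : IsDedekindDomain.HeightOneSpectrum (NumberField.RingOfIntegers K)) (α : Multiset ℂ), π.1.HasSatakeParamAt v α → ((ℓ : ℕ) : NumberField.RingOfIntegers K) ∉ v.asIdeal → r.IsUnramifiedAt v ∧ r.HasFrobCharpolyAt v (Literature.NumberTheory.Automorphic.arithFrobPolyOfSatake ι v.residueCard 2 α)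

/-- item stmt-Langlands-3124 · support · rank 9 · closed · moot by None · by planner
sources: Taylor1991, JacquetLanglands1970, HarrisSoudryTaylor1993, CalegariVenkatesh2019
[support] ConjAWindowH1 → GaloisRepWindowB: passage to characteristic 0. Known ingredients:
Matsushima–Harder Eichler–Shimura for Kleinian groups (a cohomological cuspidal π^B of trivial
central character contributes a Hecke eigenline to H^1(Γ, C) = Hom(Γ, C), Γ = O^× of suitable
(a,b)); Jacquet–Langlands (tree: named fact
`Literature.NumberTheory.Automorphic.jacquetLanglands_global`); reduction of the eigen-lattice mod
ℓ^m gives eigen-characters Γ → O_E/λ^m = finite rings A; Taylor1991 gluing of the compatible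
pseudo-representations into an ℓ-adic one, = trace of a semisimple r (Taylor's theorem);
compatibility at ALL unramified v from the principal B-positive ones up to twists by characters of
the narrow class group (Chebotarev + Brauer–Nesbitt), removed by varying (a,b). RISK carried by this
item: when nrRealPlaces K ≡ 2 mod 4 (e.g. quartic K of signature (2,1)) B must ramify at one finite
place v0, so π with no discrete-series finite component is reached only through mod-ℓ^m
level-raising congruences in H^1 of Kleinian groups (Ihara-type lemma over K) — semi-known; for
nrRealPlaces K ≡ 0 mod 4 no such issue. -/
@[route_item "route-Langlands-TorsionKudlaMillson"]
def LimitBridge : Prop :=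
  ConjAWindowH1 → GaloisRepWindowB

/-- item stmt-Langlands-3125 · assembly · rank 1 · closed · moot by None · by planner
sources: CalegariGeraghty2017
[assembly] ThetaVisibleConjA → FTraceCongruenceGeneration → EisensteinConjA → LimitBridge →
GaloisRepWindowB. Proof = pure logic plus one lemma: the units u of O with u⁻¹ ∈ O form a subgroup
of (a,b)_K^× (coordinates of products are O_K-bilinear, inverse of a unit of O is in O by
hypothesis), c is additive on it, hence c kills the closure appearing in FTraceCongruenceGeneration
as soon as it kills the theta-visible generators and (automatically) the commutators. So an
eigen-character either sees a special geodesic (ThetaVisibleConjA gives (t,d)) or kills Γ^1(N)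
(FTraceCongruenceGeneration) and is Eisenstein (EisensteinConjA gives (t,d)); this is ConjAWindowH1
(= Target, closable by the same argument), and LimitBridge carries it to the char-0 (A)-slice
GaloisRepWindowB. -/
@[route_item "route-Langlands-TorsionKudlaMillson"]
def Assembly : Prop :=
  ThetaVisibleConjA → FTraceCongruenceGeneration → EisensteinConjA → LimitBridge → GaloisRepWindowB

end Summit.Langlands.Langlands.Theses.TorsionKudlaMillson
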